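import Mathlib
import HarnessLib
import Summits.HubbardSuperconductivity.HubbardSuperconductivity.Theorems.KLProgrammeC4aUmkDirectLevelLine
import Summits.HubbardSuperconductivity.HubbardSuperconductivity.Theorems.KLProgrammeC4aKeyLemmaTangency
import Summits.HubbardSuperconductivity.HubbardSuperconductivity.Theorems.KLProgrammeC4aDirectSheetExclusionModulus
import Summits.HubbardSuperconductivity.HubbardSuperconductivity.Theorems.KLProgrammeC4aCausticWindowCover
import Summits.HubbardSuperconductivity.HubbardSuperconductivity.Theorems.KLProgrammeC4aAbsBubbleAngleLayer

/-!
# Route `KLProgramme` — crux C4a, S3 brick (B4) «(U1)-HYBRID» part D-2c: THE DIRECT TANGENCY PART ON ONE LEVEL LINE, UNDER `FrameOK` — the cut-off's support is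
# localised (`‖S − 2Φ(0,v+θ)‖ < τ₂` ⟹ `‖ϑ‖_𝕋 < W`, `‖v‖_𝕋 ≤ W`), the key lemma (D-2a) supplies the band-distance row there, and D-2b turns the level line into the
# `k = 0` envelope line with EXPLICIT `n`-free constants

Cell `gate-hubbard-kl`, seat hubbard-kl-k3c3-p3 (g36; row «implicit-function / monotonicity route for μ(n)»).  Located brick for the (C)-closer lane / the (M4)
assembly of the first-order ϑ-layer (stub (C) `stub_twoLeg_curvature` of `KLRegimeEngineV17F2`, stmt-HubbardSuperconductivity-20437), memo
HOME/hubbard-kl-k3c3-p3/U1-CAUSTIC-SUP.md §19 «(U1)-HYBRID» (D-2).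

WHY.  D-2b (`directPart_levelLine_abs_le`) bounds the direct part of the first-order layer on one level line by the `k = 0` envelope line, GIVEN the key-lemma row
`|𝒜_φ| ≤ C₁|ē| + C₂|e| + C₃|ρ|` wherever the cut-off `c` is non-zero.  For the TANGENCY cut-off (`c(v) = 0` unless `‖S(ϑ) − 2Φ(0,v+θ)‖ < τ₂`) that row is D-2a
(`abs_baseDeriv_partnerBand_pp_le_band_distance_frame`) once the support is placed in the two-node window: (i) `‖S(ϑ) − 2Φ(0,χ)‖ ≤ τ₂` for some `χ` forces
`‖ϑ‖_𝕋 < W` — the CONTRAPOSITIVE of `directSheet_excluded_of_modulus` (chord-midpoint depth, g35) under the margin row `(|ρ|/2 + ρ²/(4c′) + K_cτ₂/2)/κ < ((2u/π)W)²`;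
(ii) then `2‖Φ(0,v+θ) − Φ(0,θ)‖ ≤ ‖Φ(ρ,ϑ+θ) − Φ(0,θ)‖ + τ₂ ≤ |ρ|/(Dt−2A) + msD₁‖ϑ‖_𝕋 + τ₂` and the torus chord bound `(2u/π)‖v‖_𝕋 ≤ ‖Φ(0,v+θ) − Φ(0,θ)‖` give
`‖v‖_𝕋 ≤ (π/(4u))(|ρ|/(Dt−2A) + msD₁W + τ₂) ≤ W` (row `hvW`); (iii) the integrand is `2π`-periodic in `v`, so the key lemma is applied at the representative `v + 2πk ∈ [−W, W]`.
* `torusDist_lt_of_nearDirectCaustic`, `torusDist_loopAngle_le_of_nearDirectCaustic` — the two localisations;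
* **`directTangency_levelLine_abs_le`** (HEADLINE): for `ϑ ∈ [−π, π] ∖ {0}`, `|e| < r`, the loop circle `[−π, π]`:
  `|∫ c·J·G·(K e)′(ē)| ≤ (J₀(C₁ + C₂|e|/m + C₂|ρ|/m) + B_cJ₀ + J₁)·∫ (max m |ē|)⁻¹` with D-2a's `C₁ = M/(2c)`, `C₂ = M/(2c)·𝒦R_e + 2𝒦R_eD_e`.
What is left above it: the level/`ϑ` layers (the `k = 0` dominator; «(B4)-K0-NEG-LEVELS») and the point `ϑ = 0` (measure zero; or by continuity).
Sizes binder shape + `FrameOK` + `GeomConstants`; nothing asserts (C), K3 or superconductivity.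
References: FST II CPAM 51 (1998) §3 [cite: FeldmanSalmhoferTrubowitz1998]; BGM 2003 §7.1 [cite: BenfattoGiulianiMastropietro2003]; BGM 2006 §2.4 [cite: BenfattoGiulianiMastropietro2006].
-/

noncomputable section

namespace Summit.HubbardSuperconductivity.HubbardSuperconductivity.Theorems.C4a

set_option linter.dupNamespace false -- summit = problem name (single-conjunct summit), D-0017

open Real Set Filter MeasureTheory intervalIntegral
open scoped Topology
open Literature.MathematicalPhysics.QuantumLattice Literature.MathematicalPhysics.QuantumLattice.BandSectorCounting Literature.Probability.LatticeModels
open Literature.MathematicalPhysics.QuantumLattice.FermiRG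
open Summit.HubbardSuperconductivity.HubbardSuperconductivity.Theorems.KLRegimeSplit
open Summit.HubbardSuperconductivity.HubbardSuperconductivity.Theorems.DispersionFlow
open Summit.HubbardSuperconductivity.HubbardSuperconductivity.Theorems.PerturbedFermiCurve

section Sizes

variable {K : TrigPolyC4v} {A : ℝ} (hA : ∀ p : Momentum, ∀ j ≤ 2, ‖iteratedFDeriv ℝ j (frameShift K) p‖ ≤ A) (hA20 : A ≤ 1 / 20)
  (hd : klCurveD ≤ (bandBounds (show (-4 : ℝ) < -1.1 by norm_num) (show (-1.1 : ℝ) ≤ -0.1 by norm_num) (show (-0.1 : ℝ) < 0 by norm_num)).Dtmin - 2 * A)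
  {μ r : ℝ} (hr : 0 < r) (hlo : (-1.1 : ℝ) < μ - r - A) (hhi : μ + r + A < -0.1)
  {A₃ A₄ A₅ A₆ : ℝ} (hA₃ : ∀ p : Momentum, ‖iteratedFDeriv ℝ 3 (frameShift K) p‖ ≤ A₃)
  (hA₄ : ∀ p : Momentum, ‖iteratedFDeriv ℝ 4 (frameShift K) p‖ ≤ A₄)
  (hA₅ : ∀ p : Momentum, ‖iteratedFDeriv ℝ 5 (frameShift K) p‖ ≤ A₅)
  (hA₆ : ∀ p : Momentum, ‖iteratedFDeriv ℝ 6 (frameShift K) p‖ ≤ A₆)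
  {K₁ K₂ K₃ : ℝ} (hK₁ : ∀ p : Momentum, ‖fderiv ℝ (frameLevel μ K) p‖ ≤ K₁) (hK₂ : ∀ p : Momentum, ‖iteratedFDeriv ℝ 2 (frameLevel μ K) p‖ ≤ K₂)
  (hK₃ : ∀ p : Momentum, ‖iteratedFDeriv ℝ 3 (frameLevel μ K) p‖ ≤ K₃)
include hA hA20 hd hr hlo hhi hA₃ hA₄ hA₅ hA₆ hK₁ hK₂ hK₃

omit hA20 hd hA₃ hA₄ hA₅ hA₆ hK₁ hK₂ hK₃ in
/-- **Localisation in the relative angle**: a pair momentum within `τ₂` of the direct caustic `2·FS` has `‖ϑ‖_𝕋 < W` — the contrapositive of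
`directSheet_excluded_of_modulus` under the margin row. -/
theorem torusDist_lt_of_nearDirectCaustic {Kc r₀ g₀ w : ℝ} (hG : GeomConstants (frameLevel μ K) Kc r₀ g₀ w) {ρ : ℝ} (hρ : |ρ| < r) (θ : ℝ) {κ : ℝ}
    (hκ0 : 0 < κ) (hκ : κ ≤ (-μ - A - |ρ|) / (6 * π ^ 2) - A / 8 - A ^ 2 / (4 * (-μ - A - |ρ|))) {τ₂ W : ℝ} (hW0 : 0 ≤ W)
    (hmargin : (|ρ| / 2 + ρ ^ 2 / (4 * (-μ - A - |ρ|)) + Kc * τ₂ / 2) / κ < (2 * (bandBounds (show (-4 : ℝ) < -1.1 by norm_num) (show (-1.1 : ℝ) ≤ -0.1 by norm_num) (show (-0.1 : ℝ) < 0 by norm_num)).umin / π * W) ^ 2)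
    {ϑ χ : ℝ} (hnear : ‖pairSumPath μ K ρ ϑ θ 0 - (2 : ℝ) • levelPoint μ K 0 χ‖ ≤ τ₂) : torusDist ϑ < W := by
  by_contra hcon
  push Not at hcon
  have h := directSheet_excluded_of_modulus hA hr hlo hhi hG hρ θ hκ0 hκ hW0 hmargin ϑ hcon χ
  linarith only [h, hnear]

omit hr hK₁ hK₂ hK₃ hA₅ hA₆ in
/-- **Localisation in the loop angle**: `‖S(ϑ) − 2Φ(0,v+θ)‖ ≤ τ₂` ⟹ `(2u/π)·‖v‖_𝕋 ≤ (|ρ|/(Dt−2A) + msD₁‖ϑ‖_𝕋 + τ₂)/2`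
(`2(Φ(0,v+θ) − Φ(0,θ)) = (Φ(ρ,ϑ+θ) − Φ(0,θ)) − (S − 2Φ(0,v+θ))`, radial + angular Lipschitz bounds, torus chord bound). -/
theorem torusDist_loopAngle_le_of_nearDirectCaustic {ρ : ℝ} (hρ : |ρ| < r) (θ : ℝ) {τ₂ ϑ v : ℝ}
    (hnear : ‖pairSumPath μ K ρ ϑ θ 0 - (2 : ℝ) • levelPoint μ K 0 (v + θ)‖ ≤ τ₂) :
    2 * (bandBounds (show (-4 : ℝ) < -1.1 by norm_num) (show (-1.1 : ℝ) ≤ -0.1 by norm_num) (show (-0.1 : ℝ) < 0 by norm_num)).umin / π * torusDist v ≤ (|ρ| / ((bandBounds (show (-4 : ℝ) < -1.1 by norm_num) (show (-1.1 : ℝ) ≤ -0.1 by norm_num) (show (-0.1 : ℝ) < 0 by norm_num)).Dtmin - 2 * A) + msD A₃ A₄ 1 * torusDist ϑ + τ₂) / 2 := by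
  set B := (bandBounds (show (-4 : ℝ) < -1.1 by norm_num) (show (-1.1 : ℝ) ≤ -0.1 by norm_num) (show (-0.1 : ℝ) < 0 by norm_num)) with hBdef
  have hADt : 2 * A < B.Dtmin := by have := klCurveD_pos; linarith only [this, hd]
  have h0r : |(0 : ℝ)| < r := by simpa using lt_of_le_of_lt (abs_nonneg ρ) hρ
  have hr : 0 < r := lt_of_le_of_lt (abs_nonneg ρ) hρ
  have hρI : ρ ∈ Ioo (-r) r := abs_lt.1 hρ
  have h0I : (0 : ℝ) ∈ Ioo (-r) r := abs_lt.1 h0r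
  -- the torus chord bound for the level-0 curve
  have hl0 : (-1.1 : ℝ) ≤ μ + 0 - A := by linarith only [hlo, hr]
  have hh0 : μ + 0 + A ≤ -0.1 := by linarith only [hhi, hr]
  have hchord := norm_levelPoint_sub_ge_torusDist B hA hl0 hh0 hl0 hh0 (μ := μ) (K := K) (v + θ) θ
  rw [show v + θ - θ = v by ring] at hchord
  -- the two Lipschitz bounds
  have h1 : ‖levelPoint μ K ρ (ϑ + θ) - levelPoint μ K 0 (ϑ + θ)‖ ≤ |ρ| / (B.Dtmin - 2 * A) := by
    have := norm_levelPoint_sub_levelPoint_le B hA hADt hlo hhi hρI h0I (ϑ + θ)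
    rwa [sub_zero] at this
  have h2 : ‖levelPoint μ K 0 (ϑ + θ) - levelPoint μ K 0 θ‖ ≤ msD A₃ A₄ 1 * torusDist ϑ := by
    have := norm_levelPoint_sub_le_torusDist hA hA20 hd hlo hhi hA₃ hA₄ h0r (ϑ + θ) θ
    rwa [show ϑ + θ - θ = ϑ by ring] at this
  -- the identity
  have hid : (2 : ℝ) • (levelPoint μ K 0 (v + θ) - levelPoint μ K 0 θ) =
      ((levelPoint μ K ρ (ϑ + θ) - levelPoint μ K 0 (ϑ + θ)) + (levelPoint μ K 0 (ϑ + θ) - levelPoint μ K 0 θ)) -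
        (pairSumPath μ K ρ ϑ θ 0 - (2 : ℝ) • levelPoint μ K 0 (v + θ)) := by
    simp only [pairSumPath, add_zero, smul_sub, two_smul]; abel
  have hn : 2 * ‖levelPoint μ K 0 (v + θ) - levelPoint μ K 0 θ‖ ≤ |ρ| / (B.Dtmin - 2 * A) + msD A₃ A₄ 1 * torusDist ϑ + τ₂ := by
    have h := congrArg Norm.norm hid
    rw [norm_smul, Real.norm_eq_abs, abs_of_pos (by norm_num : (0 : ℝ) < 2)] at h
    rw [h]
    refine (norm_sub_le _ _).trans ?_
    have := norm_add_le (levelPoint μ K ρ (ϑ + θ) - levelPoint μ K 0 (ϑ + θ)) (levelPoint μ K 0 (ϑ + θ) - levelPoint μ K 0 θ)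
    linarith only [this, h1, h2, hnear]
  linarith only [hchord, hn]

set_option maxHeartbeats 400000 in
/-- **THE DIRECT TANGENCY PART ON ONE LEVEL LINE, UNDER `FrameOK`** (HEADLINE; see the module docstring). -/
theorem directTangency_levelLine_abs_le {R : RenConsts} {U : ℝ} {N : ℕ} (hF : FrameOK R U N μ K) {Kc r₀ g₀ w : ℝ} (hG : GeomConstants (frameLevel μ K) Kc r₀ g₀ w)
    {W K₀ : ℝ}
    (hW : W * (2 * K₃ * msD A₃ A₄ 1 ^ 3 + 4 * K₂ * msD A₃ A₄ 1 * msD A₃ A₄ 2 + K₁ * msD A₃ A₄ 3) ≤ 3 / 200 * (bandBounds (show (-4 : ℝ) < -1.1 by norm_num) (show (-1.1 : ℝ) ≤ -0.1 by norm_num) (show (-0.1 : ℝ) < 0 by norm_num)).umin ^ 2)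
    (hW0 : 0 ≤ W) (hK₀ : ∀ p : Momentum, |frameLevel μ K p| ≤ K₀)
    {ρ : ℝ} (hρ : |ρ| < r) (θ : ℝ) {κ τ₂ : ℝ} (hκ0 : 0 < κ) (hκ : κ ≤ (-μ - A - |ρ|) / (6 * π ^ 2) - A / 8 - A ^ 2 / (4 * (-μ - A - |ρ|)))
    (hmargin : (|ρ| / 2 + ρ ^ 2 / (4 * (-μ - A - |ρ|)) + Kc * τ₂ / 2) / κ < (2 * (bandBounds (show (-4 : ℝ) < -1.1 by norm_num) (show (-1.1 : ℝ) ≤ -0.1 by norm_num) (show (-0.1 : ℝ) < 0 by norm_num)).umin / π * W) ^ 2)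
    (hvW : π / (4 * (bandBounds (show (-4 : ℝ) < -1.1 by norm_num) (show (-1.1 : ℝ) ≤ -0.1 by norm_num) (show (-0.1 : ℝ) < 0 by norm_num)).umin) * (|ρ| / ((bandBounds (show (-4 : ℝ) < -1.1 by norm_num) (show (-1.1 : ℝ) ≤ -0.1 by norm_num) (show (-0.1 : ℝ) < 0 by norm_num)).Dtmin - 2 * A) + msD A₃ A₄ 1 * W + τ₂) ≤ W)
    {ϑ : ℝ} (hϑI : ϑ ∈ Icc (-π) π) (hϑ0 : ϑ ≠ 0) {e : ℝ} (he : |e| < r) {c J Kr : ℝ → ℝ} {Bc J₀ J₁ m : ℝ}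
    (hc : ContDiff ℝ 1 c) (hcb : ∀ v, |c v| ≤ 1) (hc1 : ∀ v, |deriv c v| ≤ Bc) (hcper : ∀ v, c (v + 2 * π) = c v)
    (hcsupp : ∀ v, τ₂ ≤ ‖pairSumPath μ K ρ ϑ θ 0 - (2 : ℝ) • levelPoint μ K 0 (v + θ)‖ → c v = 0)
    (hJ : ContDiff ℝ 1 J) (hJb : ∀ v, |J v| ≤ J₀) (hJ1 : ∀ v, |deriv J v| ≤ J₁) (hJper : ∀ v, J (v + 2 * π) = J v)
    (hK : ContDiff ℝ 1 Kr) (hm : 0 < m) (hK0 : ∀ u, |Kr u| ≤ (max m |u|)⁻¹) (hK1 : ∀ u, |deriv Kr u| ≤ (max m |u|)⁻¹ ^ 2) :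
    |∫ v in (-π)..π, c v * J v * ((fderiv ℝ (frameLevel μ K) (pairSumPath μ K ρ ϑ θ 0 - levelPoint μ K e (v + θ)))
        (iteratedDeriv 1 (levelPoint μ K 0) θ + iteratedDeriv 1 (levelPoint μ K ρ) (ϑ + θ)) *
        deriv Kr (frameLevel μ K (pairSumPath μ K ρ ϑ θ 0 - levelPoint μ K e (v + θ))))| ≤
      (J₀ * ((6 * (max (max K₀ K₁) (max K₂ K₃)) * (max 1 (max (4 * msD A₃ A₄ 1) (max (6 * msD A₃ A₄ 2) (10 * msD A₃ A₄ 3)))) ^ 3) / (2 * (3 / 400 * (bandBounds (show (-4 : ℝ) < -1.1 by norm_num) (show (-1.1 : ℝ) ≤ -0.1 by norm_num) (show (-0.1 : ℝ) < 0 by norm_num)).umin ^ 2)) + ((6 * (max (max K₀ K₁) (max K₂ K₃)) * (max 1 (max (4 * msD A₃ A₄ 1) (max (6 * msD A₃ A₄ 2) (10 * msD A₃ A₄ 3)))) ^ 3) / (2 * (3 / 400 * (bandBounds (show (-4 : ℝ) < -1.1 by norm_num) (show (-1.1 : ℝ) ≤ -0.1 by norm_num) (show (-0.1 : ℝ) <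 0 by norm_num)).umin ^ 2)) * ((max (max K₀ K₁) (max K₂ K₃)) * max (1 / ((bandBounds (show (-4 : ℝ) < -1.1 by norm_num) (show (-1.1 : ℝ) ≤ -0.1 by norm_num) (show (-0.1 : ℝ) < 0 by norm_num)).Dtmin - 2 * A)) (radialRowOneConst A ((bandBounds (show (-4 : ℝ) < -1.1 by norm_num) (show (-1.1 : ℝ) ≤ -0.1 by norm_num) (show (-0.1 : ℝ) < 0 by norm_num)).Dtmin - 2 * A))) + (1 + 1 : ℕ).factorial * (max (max K₀ K₁) (max K₂ K₃)) * max (1 / ((bandBounds (show (-4 : ℝ) < -1.1 by norm_num) (show (-1.1 : ℝ) ≤ -0.1 by norm_num) (show (-0.1 : ℝ) < 0 by norm_num)).Dtmin - 2 * A)) (radialRowOneConst A ((bandBounds (show (-4 : ℝ) < -1.1 by norm_num) (show (-1.1 : ℝ) ≤ -0.1 by norm_num) (show (-0.1 : ℝ) < 0 by norm_num)).Dtmin - 2 * A)) * (max 1 (3 * msD A₃ A₄ 1 + r * radialRowOneConst A ((bandBounds (show (-4 : ℝ) < -1.1 by norm_num) (show (-1.1 : ℝ) ≤ -0.1 by norm_num)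 (show (-0.1 : ℝ) < 0 by norm_num)).Dtmin - 2 * A))) ^ 1) * (|e| / m) + ((6 * (max (max K₀ K₁) (max K₂ K₃)) * (max 1 (max (4 * msD A₃ A₄ 1) (max (6 * msD A₃ A₄ 2) (10 * msD A₃ A₄ 3)))) ^ 3) / (2 * (3 / 400 * (bandBounds (show (-4 : ℝ) < -1.1 by norm_num) (show (-1.1 : ℝ) ≤ -0.1 by norm_num) (show (-0.1 : ℝ) < 0 by norm_num)).umin ^ 2)) * ((max (max K₀ K₁) (max K₂ K₃)) * max (1 / ((bandBounds (show (-4 : ℝ) < -1.1 by norm_num) (show (-1.1 : ℝ) ≤ -0.1 by norm_num) (show (-0.1 : ℝ) < 0 by norm_num)).Dtmin - 2 * A)) (radialRowOneConst A ((bandBounds (show (-4 : ℝ) < -1.1 by norm_num) (show (-1.1 : ℝ) ≤ -0.1 by norm_num) (show (-0.1 : ℝ) < 0 by norm_num)).Dtmin - 2 * A))) + (1 + 1 : ℕ).factorial * (max (max K₀ K₁) (max K₂ K₃)) * max (1 / ((bandBounds (show (-4 : ℝ) < -1.1 by norm_num) (show (-1.1 : ℝ) ≤ -0.1 by norm_num)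 (show (-0.1 : ℝ) < 0 by norm_num)).Dtmin - 2 * A)) (radialRowOneConst A ((bandBounds (show (-4 : ℝ) < -1.1 by norm_num) (show (-1.1 : ℝ) ≤ -0.1 by norm_num) (show (-0.1 : ℝ) < 0 by norm_num)).Dtmin - 2 * A)) * (max 1 (3 * msD A₃ A₄ 1 + r * radialRowOneConst A ((bandBounds (show (-4 : ℝ) < -1.1 by norm_num) (show (-1.1 : ℝ) ≤ -0.1 by norm_num) (show (-0.1 : ℝ) < 0 by norm_num)).Dtmin - 2 * A))) ^ 1) * (|ρ| / m)) + (Bc * J₀ + J₁)) *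
        ∫ v in (-π)..π, (max m |frameLevel μ K (pairSumPath μ K ρ ϑ θ 0 - levelPoint μ K e (v + θ))|)⁻¹ := by
  set B := (bandBounds (show (-4 : ℝ) < -1.1 by norm_num) (show (-1.1 : ℝ) ≤ -0.1 by norm_num) (show (-0.1 : ℝ) < 0 by norm_num)) with hBdef
  have hADt : 2 * A < B.Dtmin := by have := klCurveD_pos; linarith only [this, hd]
  have hDt : 0 < B.Dtmin - 2 * A := by linarith only [hADt]
  have hA0 : 0 ≤ A := le_trans (norm_nonneg _) (hA 0 0 (by norm_num))
  have hu : 0 < B.umin := B.umin_pos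
  have hD1 : 0 ≤ msD A₃ A₄ 1 := (norm_nonneg _).trans (norm_iteratedDeriv_levelPoint_le hA hA20 hd hlo hhi hA₃ hA₄ hρ le_rfl (by norm_num) 0)
  have h𝒦0 : 0 ≤ (max (max K₀ K₁) (max K₂ K₃)) := le_trans (le_trans (abs_nonneg _) (hK₀ 0)) ((le_max_left _ _).trans (le_max_left _ _))
  have hRR0 : 0 ≤ radialRowOneConst A (B.Dtmin - 2 * A) := radialRowOneConst_nonneg hA0 hDt
  have hRe0 : 0 ≤ max (1 / (B.Dtmin - 2 * A)) (radialRowOneConst A (B.Dtmin - 2 * A)) := le_trans (by positivity) (le_max_left _ _)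
  have hDD0 : 0 ≤ (max 1 (max (4 * msD A₃ A₄ 1) (max (6 * msD A₃ A₄ 2) (10 * msD A₃ A₄ 3)))) := zero_le_one.trans (le_max_left _ _)
  have hDe0 : 0 ≤ (max 1 (3 * msD A₃ A₄ 1 + r * radialRowOneConst A (B.Dtmin - 2 * A))) := zero_le_one.trans (le_max_left _ _)
  have hϑabs : |ϑ| ≤ π := abs_le.2 ⟨by linarith only [hϑI.1], hϑI.2⟩
  have hϑT : torusDist ϑ = |ϑ| := torusDist_eq_abs_of_abs_le_pi hϑabs
  have hC1 : 0 ≤ (6 * (max (max K₀ K₁) (max K₂ K₃)) * (max 1 (max (4 * msD A₃ A₄ 1) (max (6 * msD A₃ A₄ 2) (10 * msD A₃ A₄ 3)))) ^ 3) / (2 * (3 / 400 * B.umin ^ 2)) := by positivity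
  have hC23 : 0 ≤ ((6 * (max (max K₀ K₁) (max K₂ K₃)) * (max 1 (max (4 * msD A₃ A₄ 1) (max (6 * msD A₃ A₄ 2) (10 * msD A₃ A₄ 3)))) ^ 3) / (2 * (3 / 400 * B.umin ^ 2)) * ((max (max K₀ K₁) (max K₂ K₃)) * max (1 / (B.Dtmin - 2 * A)) (radialRowOneConst A (B.Dtmin - 2 * A))) + (1 + 1 : ℕ).factorial * (max (max K₀ K₁) (max K₂ K₃)) * max (1 / (B.Dtmin - 2 * A)) (radialRowOneConst A (B.Dtmin - 2 * A)) * (max 1 (3 * msD A₃ A₄ 1 + r * radialRowOneConst A (B.Dtmin - 2 * A))) ^ 1) := by positivity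
  refine directPart_levelLine_abs_le hA hd hr hlo hhi hρ he ϑ θ (C₁ := (6 * (max (max K₀ K₁) (max K₂ K₃)) * (max 1 (max (4 * msD A₃ A₄ 1) (max (6 * msD A₃ A₄ 2) (10 * msD A₃ A₄ 3)))) ^ 3) / (2 * (3 / 400 * B.umin ^ 2)))
    (C₂ := ((6 * (max (max K₀ K₁) (max K₂ K₃)) * (max 1 (max (4 * msD A₃ A₄ 1) (max (6 * msD A₃ A₄ 2) (10 * msD A₃ A₄ 3)))) ^ 3) / (2 * (3 / 400 * B.umin ^ 2)) * ((max (max K₀ K₁) (max K₂ K₃)) * max (1 / (B.Dtmin - 2 * A)) (radialRowOneConst A (B.Dtmin - 2 * A))) + (1 + 1 : ℕ).factorial * (max (max K₀ K₁) (max K₂ K₃)) * max (1 / (B.Dtmin - 2 * A)) (radialRowOneConst A (B.Dtmin - 2 * A)) * (max 1 (3 * msD A₃ A₄ 1 + r * radialRowOneConst A (B.Dtmin - 2 * A))) ^ 1))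
    (C₃ := ((6 * (max (max K₀ K₁) (max K₂ K₃)) * (max 1 (max (4 * msD A₃ A₄ 1) (max (6 * msD A₃ A₄ 2) (10 * msD A₃ A₄ 3)))) ^ 3) / (2 * (3 / 400 * B.umin ^ 2)) * ((max (max K₀ K₁) (max K₂ K₃)) * max (1 / (B.Dtmin - 2 * A)) (radialRowOneConst A (B.Dtmin - 2 * A))) + (1 + 1 : ℕ).factorial * (max (max K₀ K₁) (max K₂ K₃)) * max (1 / (B.Dtmin - 2 * A)) (radialRowOneConst A (B.Dtmin - 2 * A)) * (max 1 (3 * msD A₃ A₄ 1 + r * radialRowOneConst A (B.Dtmin - 2 * A))) ^ 1))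
    hc hcb hc1 hcper hJ hJb hJ1 hJper hK hm hK0 hK1 hC1 hC23 hC23 ?_
  intro v hcv
  have hnear : ‖pairSumPath μ K ρ ϑ θ 0 - (2 : ℝ) • levelPoint μ K 0 (v + θ)‖ ≤ τ₂ := (lt_of_not_ge fun h => hcv (hcsupp v h)).le
  -- (i) the relative angle sits in the two-node window
  have hϑW' : torusDist ϑ < W := torusDist_lt_of_nearDirectCaustic hA hr hlo hhi hG hρ θ hκ0 hκ hW0 hmargin hnear
  have hϑW : |ϑ| ≤ W := by rw [← hϑT]; exact hϑW'.le
  -- (ii) the loop angle, up to a period, sits in the two-node window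
  have hvT := torusDist_loopAngle_le_of_nearDirectCaustic hA hA20 hd hlo hhi hA₃ hA₄ hρ θ hnear
  have hvW : torusDist v ≤ W := by
    have h1 : msD A₃ A₄ 1 * torusDist ϑ ≤ msD A₃ A₄ 1 * W := mul_le_mul_of_nonneg_left hϑW'.le hD1
    have h2 : 2 * B.umin / π * torusDist v ≤ (|ρ| / (B.Dtmin - 2 * A) + msD A₃ A₄ 1 * W + τ₂) / 2 := by linarith only [hvT, h1]
    have h3 : torusDist v ≤ π / (4 * B.umin) * (|ρ| / (B.Dtmin - 2 * A) + msD A₃ A₄ 1 * W + τ₂) := by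
      rw [div_mul_eq_mul_div, le_div_iff₀ (by positivity)]
      have := mul_le_mul_of_nonneg_left h2 (show (0 : ℝ) ≤ π * 2 by positivity)
      calc torusDist v * (4 * B.umin) = π * 2 * (2 * B.umin / π * torusDist v) := by field_simp; ring
        _ ≤ π * 2 * ((|ρ| / (B.Dtmin - 2 * A) + msD A₃ A₄ 1 * W + τ₂) / 2) := this
        _ = π * (|ρ| / (B.Dtmin - 2 * A) + msD A₃ A₄ 1 * W + τ₂) := by ring
    exact h3.trans hvW
  obtain ⟨k, hk⟩ := exists_torusDist_eq_abs v
  set φ : ℝ := v + k * (2 * π) with hφdef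
  have hφW : |φ| ≤ W := by rw [hφdef, ← hk]; exact hvW
  -- (iii) the key lemma at the representative `φ`, transported back by periodicity
  have hkeyφ := abs_baseDeriv_partnerBand_pp_le_band_distance_frame hA hA20 hd hr hlo hhi hA₃ hA₄ hA₅ hA₆ hK₁ hK₂ hK₃ hF hW hK₀ hϑ0 hϑW θ hρ he hφW
  have hper : ∀ ψ : ℝ, levelPoint μ K e (φ + ψ) = levelPoint μ K e (v + ψ) := fun ψ => by
    rw [hφdef, show v + (k : ℝ) * (2 * π) + ψ = v + ψ + 2 * π * (k : ℝ) by ring, levelPoint_add_int_mul_two_pi]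
  have hfun : (fun ψ : ℝ => frameLevel μ K (levelPoint μ K 0 ψ + levelPoint μ K ρ (ϑ + ψ) - levelPoint μ K e (φ + ψ))) =
      fun ψ : ℝ => frameLevel μ K (levelPoint μ K 0 ψ + levelPoint μ K ρ (ϑ + ψ) - levelPoint μ K e (v + ψ)) := by
    funext ψ; rw [hper ψ]
  have hS : levelPoint μ K 0 θ + levelPoint μ K ρ (ϑ + θ) - levelPoint μ K e (φ + θ) = pairSumPath μ K ρ ϑ θ 0 - levelPoint μ K e (v + θ) := by
    rw [hper θ]; simp only [pairSumPath, add_zero]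
  rw [hfun, hS] at hkeyφ
  exact hkeyφ

set_option maxHeartbeats 400000 in
/-- **THE DIRECT TANGENCY PART ON ONE LEVEL LINE — SEPARATE ANGLE WINDOWS**: `directTangency_levelLine_abs_le` with the margin row on a relative-angle window
`Wϑ ≤ W` and the loop-angle row `(π/(4u))(|ρ|/(Dt−2A) + msD₁·Wϑ + τ₂) ≤ W` (the un-primed row, `Wϑ = W`, is infeasible for `W > 0` since `π·msD₁/(4u_min) > 1` with the
tree's size table — located g37; this is the usable form). -/
theorem directTangency_levelLine_abs_le' {R : RenConsts} {U : ℝ} {N : ℕ} (hF : FrameOK R U N μ K) {Kc r₀ g₀ w : ℝ} (hG : GeomConstants (frameLevel μ K) Kc r₀ g₀ w)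
    {W K₀ : ℝ}
    (hW : W * (2 * K₃ * msD A₃ A₄ 1 ^ 3 + 4 * K₂ * msD A₃ A₄ 1 * msD A₃ A₄ 2 + K₁ * msD A₃ A₄ 3) ≤ 3 / 200 * (bandBounds (show (-4 : ℝ) < -1.1 by norm_num) (show (-1.1 : ℝ) ≤ -0.1 by norm_num) (show (-0.1 : ℝ) < 0 by norm_num)).umin ^ 2)
    (hK₀ : ∀ p : Momentum, |frameLevel μ K p| ≤ K₀)
    {ρ : ℝ} (hρ : |ρ| < r) (θ : ℝ) {κ τ₂ Wϑ : ℝ} (hκ0 : 0 < κ) (hκ : κ ≤ (-μ - A - |ρ|) / (6 * π ^ 2) - A / 8 - A ^ 2 / (4 * (-μ - A - |ρ|)))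
    (hWϑ0 : 0 ≤ Wϑ) (hWϑ : Wϑ ≤ W)
    (hmargin : (|ρ| / 2 + ρ ^ 2 / (4 * (-μ - A - |ρ|)) + Kc * τ₂ / 2) / κ < (2 * (bandBounds (show (-4 : ℝ) < -1.1 by norm_num) (show (-1.1 : ℝ) ≤ -0.1 by norm_num) (show (-0.1 : ℝ) < 0 by norm_num)).umin / π * Wϑ) ^ 2)
    (hvW : π / (4 * (bandBounds (show (-4 : ℝ) < -1.1 by norm_num) (show (-1.1 : ℝ) ≤ -0.1 by norm_num) (show (-0.1 : ℝ) < 0 by norm_num)).umin) * (|ρ| / ((bandBounds (show (-4 : ℝ) < -1.1 by norm_num) (show (-1.1 : ℝ) ≤ -0.1 by norm_num) (show (-0.1 : ℝ) < 0 by norm_num)).Dtmin - 2 * A) + msD A₃ A₄ 1 * Wϑ + τ₂) ≤ W)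
    {ϑ : ℝ} (hϑI : ϑ ∈ Icc (-π) π) (hϑ0 : ϑ ≠ 0) {e : ℝ} (he : |e| < r) {c J Kr : ℝ → ℝ} {Bc J₀ J₁ m : ℝ}
    (hc : ContDiff ℝ 1 c) (hcb : ∀ v, |c v| ≤ 1) (hc1 : ∀ v, |deriv c v| ≤ Bc) (hcper : ∀ v, c (v + 2 * π) = c v)
    (hcsupp : ∀ v, τ₂ ≤ ‖pairSumPath μ K ρ ϑ θ 0 - (2 : ℝ) • levelPoint μ K 0 (v + θ)‖ → c v = 0)
    (hJ : ContDiff ℝ 1 J) (hJb : ∀ v, |J v| ≤ J₀) (hJ1 : ∀ v, |deriv J v| ≤ J₁) (hJper : ∀ v, J (v + 2 * π) = J v)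
    (hK : ContDiff ℝ 1 Kr) (hm : 0 < m) (hK0 : ∀ u, |Kr u| ≤ (max m |u|)⁻¹) (hK1 : ∀ u, |deriv Kr u| ≤ (max m |u|)⁻¹ ^ 2) :
    |∫ v in (-π)..π, c v * J v * ((fderiv ℝ (frameLevel μ K) (pairSumPath μ K ρ ϑ θ 0 - levelPoint μ K e (v + θ)))
        (iteratedDeriv 1 (levelPoint μ K 0) θ + iteratedDeriv 1 (levelPoint μ K ρ) (ϑ + θ)) *
        deriv Kr (frameLevel μ K (pairSumPath μ K ρ ϑ θ 0 - levelPoint μ K e (v + θ))))| ≤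
      (J₀ * ((6 * (max (max K₀ K₁) (max K₂ K₃)) * (max 1 (max (4 * msD A₃ A₄ 1) (max (6 * msD A₃ A₄ 2) (10 * msD A₃ A₄ 3)))) ^ 3) / (2 * (3 / 400 * (bandBounds (show (-4 : ℝ) < -1.1 by norm_num) (show (-1.1 : ℝ) ≤ -0.1 by norm_num) (show (-0.1 : ℝ) < 0 by norm_num)).umin ^ 2)) + ((6 * (max (max K₀ K₁) (max K₂ K₃)) * (max 1 (max (4 * msD A₃ A₄ 1) (max (6 * msD A₃ A₄ 2) (10 * msD A₃ A₄ 3)))) ^ 3) / (2 * (3 / 400 * (bandBounds (show (-4 : ℝ) < -1.1 by norm_num) (show (-1.1 : ℝ) ≤ -0.1 by norm_num) (show (-0.1 : ℝ) < 0 by norm_num)).umin ^ 2)) * ((max (max K₀ K₁) (max K₂ K₃)) * max (1 / ((bandBounds (show (-4 : ℝ) < -1.1 by norm_num) (show (-1.1 : ℝ) ≤ -0.1 by norm_num) (show (-0.1 : ℝ) < 0 by norm_num)).Dtmin - 2 * A)) (radialRowOneConst A ((bandBounds (show (-4 : ℝ) < -1.1 by norm_num) (show (-1.1 : ℝ) ≤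 -0.1 by norm_num) (show (-0.1 : ℝ) < 0 by norm_num)).Dtmin - 2 * A))) + (1 + 1 : ℕ).factorial * (max (max K₀ K₁) (max K₂ K₃)) * max (1 / ((bandBounds (show (-4 : ℝ) < -1.1 by norm_num) (show (-1.1 : ℝ) ≤ -0.1 by norm_num) (show (-0.1 : ℝ) < 0 by norm_num)).Dtmin - 2 * A)) (radialRowOneConst A ((bandBounds (show (-4 : ℝ) < -1.1 by norm_num) (show (-1.1 : ℝ) ≤ -0.1 by norm_num) (show (-0.1 : ℝ) < 0 by norm_num)).Dtmin - 2 * A)) * (max 1 (3 * msD A₃ A₄ 1 + r * radialRowOneConst A ((bandBounds (show (-4 : ℝ) < -1.1 by norm_num) (show (-1.1 : ℝ) ≤ -0.1 by norm_num) (show (-0.1 : ℝ) < 0 by norm_num)).Dtmin - 2 * A))) ^ 1) * (|e| / m) + ((6 * (max (max K₀ K₁) (max K₂ K₃)) * (max 1 (max (4 * msD A₃ A₄ 1) (max (6 * msD A₃ A₄ 2) (10 * msD A₃ A₄ 3)))) ^ 3) / (2 * (3 / 400 * (bandBounds (show (-4 : ℝ) < -1.1 by norm_num) (show (-1.1 :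 ℝ) ≤ -0.1 by norm_num) (show (-0.1 : ℝ) < 0 by norm_num)).umin ^ 2)) * ((max (max K₀ K₁) (max K₂ K₃)) * max (1 / ((bandBounds (show (-4 : ℝ) < -1.1 by norm_num) (show (-1.1 : ℝ) ≤ -0.1 by norm_num) (show (-0.1 : ℝ) < 0 by norm_num)).Dtmin - 2 * A)) (radialRowOneConst A ((bandBounds (show (-4 : ℝ) < -1.1 by norm_num) (show (-1.1 : ℝ) ≤ -0.1 by norm_num) (show (-0.1 : ℝ) < 0 by norm_num)).Dtmin - 2 * A))) + (1 + 1 : ℕ).factorial * (max (max K₀ K₁) (max K₂ K₃)) * max (1 / ((bandBounds (show (-4 : ℝ) < -1.1 by norm_num) (show (-1.1 : ℝ) ≤ -0.1 by norm_num) (show (-0.1 : ℝ) < 0 by norm_num)).Dtmin - 2 * A)) (radialRowOneConst A ((bandBounds (show (-4 : ℝ) < -1.1 by norm_num) (show (-1.1 : ℝ) ≤ -0.1 by norm_num) (show (-0.1 : ℝ) < 0 by norm_num)).Dtmin - 2 * A)) * (max 1 (3 * msD A₃ A₄ 1 + r * radialRowOneConst A ((bandBounds (show (-4 : ℝ) <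 -1.1 by norm_num) (show (-1.1 : ℝ) ≤ -0.1 by norm_num) (show (-0.1 : ℝ) < 0 by norm_num)).Dtmin - 2 * A))) ^ 1) * (|ρ| / m)) + (Bc * J₀ + J₁)) *
        ∫ v in (-π)..π, (max m |frameLevel μ K (pairSumPath μ K ρ ϑ θ 0 - levelPoint μ K e (v + θ))|)⁻¹ := by
  set B := (bandBounds (show (-4 : ℝ) < -1.1 by norm_num) (show (-1.1 : ℝ) ≤ -0.1 by norm_num) (show (-0.1 : ℝ) < 0 by norm_num)) with hBdef
  have hADt : 2 * A < B.Dtmin := by have := klCurveD_pos; linarith only [this, hd]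
  have hDt : 0 < B.Dtmin - 2 * A := by linarith only [hADt]
  have hA0 : 0 ≤ A := le_trans (norm_nonneg _) (hA 0 0 (by norm_num))
  have hu : 0 < B.umin := B.umin_pos
  have hD1 : 0 ≤ msD A₃ A₄ 1 := (norm_nonneg _).trans (norm_iteratedDeriv_levelPoint_le hA hA20 hd hlo hhi hA₃ hA₄ hρ le_rfl (by norm_num) 0)
  have h𝒦0 : 0 ≤ (max (max K₀ K₁) (max K₂ K₃)) := le_trans (le_trans (abs_nonneg _) (hK₀ 0)) ((le_max_left _ _).trans (le_max_left _ _))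
  have hRR0 : 0 ≤ radialRowOneConst A (B.Dtmin - 2 * A) := radialRowOneConst_nonneg hA0 hDt
  have hRe0 : 0 ≤ max (1 / (B.Dtmin - 2 * A)) (radialRowOneConst A (B.Dtmin - 2 * A)) := le_trans (by positivity) (le_max_left _ _)
  have hDD0 : 0 ≤ (max 1 (max (4 * msD A₃ A₄ 1) (max (6 * msD A₃ A₄ 2) (10 * msD A₃ A₄ 3)))) := zero_le_one.trans (le_max_left _ _)
  have hDe0 : 0 ≤ (max 1 (3 * msD A₃ A₄ 1 + r * radialRowOneConst A (B.Dtmin - 2 * A))) := zero_le_one.trans (le_max_left _ _)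
  have hϑabs : |ϑ| ≤ π := abs_le.2 ⟨by linarith only [hϑI.1], hϑI.2⟩
  have hϑT : torusDist ϑ = |ϑ| := torusDist_eq_abs_of_abs_le_pi hϑabs
  have hC1 : 0 ≤ (6 * (max (max K₀ K₁) (max K₂ K₃)) * (max 1 (max (4 * msD A₃ A₄ 1) (max (6 * msD A₃ A₄ 2) (10 * msD A₃ A₄ 3)))) ^ 3) / (2 * (3 / 400 * B.umin ^ 2)) := by positivity
  have hC23 : 0 ≤ ((6 * (max (max K₀ K₁) (max K₂ K₃)) * (max 1 (max (4 * msD A₃ A₄ 1) (max (6 * msD A₃ A₄ 2) (10 * msD A₃ A₄ 3)))) ^ 3) / (2 * (3 / 400 * B.umin ^ 2)) * ((max (max K₀ K₁) (max K₂ K₃)) * max (1 / (B.Dtmin - 2 * A)) (radialRowOneConst A (B.Dtmin - 2 * A))) + (1 + 1 : ℕ).factorial * (max (max K₀ K₁) (max K₂ K₃)) * max (1 / (B.Dtmin - 2 * A)) (radialRowOneConst A (B.Dtmin - 2 * A)) * (max 1 (3 * msD A₃ A₄ 1 + r * radialRowOneConst A (B.Dtmin - 2 * A))) ^ 1) :=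 by positivity
  refine directPart_levelLine_abs_le hA hd hr hlo hhi hρ he ϑ θ (C₁ := (6 * (max (max K₀ K₁) (max K₂ K₃)) * (max 1 (max (4 * msD A₃ A₄ 1) (max (6 * msD A₃ A₄ 2) (10 * msD A₃ A₄ 3)))) ^ 3) / (2 * (3 / 400 * B.umin ^ 2)))
    (C₂ := ((6 * (max (max K₀ K₁) (max K₂ K₃)) * (max 1 (max (4 * msD A₃ A₄ 1) (max (6 * msD A₃ A₄ 2) (10 * msD A₃ A₄ 3)))) ^ 3) / (2 * (3 / 400 * B.umin ^ 2)) * ((max (max K₀ K₁) (max K₂ K₃)) * max (1 / (B.Dtmin - 2 * A)) (radialRowOneConst A (B.Dtmin - 2 * A))) + (1 + 1 : ℕ).factorial * (max (max K₀ K₁) (max K₂ K₃)) * max (1 / (B.Dtmin - 2 * A)) (radialRowOneConst A (B.Dtmin - 2 * A)) * (max 1 (3 * msD A₃ A₄ 1 + r * radialRowOneConst A (B.Dtmin - 2 * A))) ^ 1))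
    (C₃ := ((6 * (max (max K₀ K₁) (max K₂ K₃)) * (max 1 (max (4 * msD A₃ A₄ 1) (max (6 * msD A₃ A₄ 2) (10 * msD A₃ A₄ 3)))) ^ 3) / (2 * (3 / 400 * B.umin ^ 2)) * ((max (max K₀ K₁) (max K₂ K₃)) * max (1 / (B.Dtmin - 2 * A)) (radialRowOneConst A (B.Dtmin - 2 * A))) + (1 + 1 : ℕ).factorial * (max (max K₀ K₁) (max K₂ K₃)) * max (1 / (B.Dtmin - 2 * A)) (radialRowOneConst A (B.Dtmin - 2 * A)) * (max 1 (3 * msD A₃ A₄ 1 + r * radialRowOneConst A (B.Dtmin - 2 * A))) ^ 1))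
    hc hcb hc1 hcper hJ hJb hJ1 hJper hK hm hK0 hK1 hC1 hC23 hC23 ?_
  intro v hcv
  have hnear : ‖pairSumPath μ K ρ ϑ θ 0 - (2 : ℝ) • levelPoint μ K 0 (v + θ)‖ ≤ τ₂ := (lt_of_not_ge fun h => hcv (hcsupp v h)).le
  -- (i) the relative angle sits in the two-node window
  have hϑW' : torusDist ϑ < Wϑ := torusDist_lt_of_nearDirectCaustic hA hr hlo hhi hG hρ θ hκ0 hκ hWϑ0 hmargin hnear
  have hϑW : |ϑ| ≤ W := by rw [← hϑT]; exact hϑW'.le.trans hWϑ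
  -- (ii) the loop angle, up to a period, sits in the two-node window
  have hvT := torusDist_loopAngle_le_of_nearDirectCaustic hA hA20 hd hlo hhi hA₃ hA₄ hρ θ hnear
  have hvW : torusDist v ≤ W := by
    have h1 : msD A₃ A₄ 1 * torusDist ϑ ≤ msD A₃ A₄ 1 * Wϑ := mul_le_mul_of_nonneg_left hϑW'.le hD1
    have h2 : 2 * B.umin / π * torusDist v ≤ (|ρ| / (B.Dtmin - 2 * A) + msD A₃ A₄ 1 * Wϑ + τ₂) / 2 := by linarith only [hvT, h1]
    have h3 : torusDist v ≤ π / (4 * B.umin) * (|ρ| / (B.Dtmin - 2 * A) + msD A₃ A₄ 1 * Wϑ + τ₂) := by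
      rw [div_mul_eq_mul_div, le_div_iff₀ (by positivity)]
      have := mul_le_mul_of_nonneg_left h2 (show (0 : ℝ) ≤ π * 2 by positivity)
      calc torusDist v * (4 * B.umin) = π * 2 * (2 * B.umin / π * torusDist v) := by field_simp; ring
        _ ≤ π * 2 * ((|ρ| / (B.Dtmin - 2 * A) + msD A₃ A₄ 1 * Wϑ + τ₂) / 2) := this
        _ = π * (|ρ| / (B.Dtmin - 2 * A) + msD A₃ A₄ 1 * Wϑ + τ₂) := by ring
    exact h3.trans hvW
  obtain ⟨k, hk⟩ := exists_torusDist_eq_abs v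
  set φ : ℝ := v + k * (2 * π) with hφdef
  have hφW : |φ| ≤ W := by rw [hφdef, ← hk]; exact hvW
  -- (iii) the key lemma at the representative `φ`, transported back by periodicity
  have hkeyφ := abs_baseDeriv_partnerBand_pp_le_band_distance_frame hA hA20 hd hr hlo hhi hA₃ hA₄ hA₅ hA₆ hK₁ hK₂ hK₃ hF hW hK₀ hϑ0 hϑW θ hρ he hφW
  have hper : ∀ ψ : ℝ, levelPoint μ K e (φ + ψ) = levelPoint μ K e (v + ψ) := fun ψ => by
    rw [hφdef, show v + (k : ℝ) * (2 * π) + ψ = v + ψ + 2 * π * (k : ℝ) by ring, levelPoint_add_int_mul_two_pi]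
  have hfun : (fun ψ : ℝ => frameLevel μ K (levelPoint μ K 0 ψ + levelPoint μ K ρ (ϑ + ψ) - levelPoint μ K e (φ + ψ))) =
      fun ψ : ℝ => frameLevel μ K (levelPoint μ K 0 ψ + levelPoint μ K ρ (ϑ + ψ) - levelPoint μ K e (v + ψ)) := by
    funext ψ; rw [hper ψ]
  have hS : levelPoint μ K 0 θ + levelPoint μ K ρ (ϑ + θ) - levelPoint μ K e (φ + θ) = pairSumPath μ K ρ ϑ θ 0 - levelPoint μ K e (v + θ) := by
    rw [hper θ]; simp only [pairSumPath, add_zero]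
  rw [hfun, hS] at hkeyφ
  exact hkeyφ

end Sizes

end Summit.HubbardSuperconductivity.HubbardSuperconductivity.Theorems.C4a

end
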